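import Summits.AtomisticToContinuum.Crystallization.Theses.DisclinationRation
import Summits.AtomisticToContinuum.Crystallization.Theorems.HullExactificationCascadeHullGoodEverywhereSnap
import Literature.MathematicalPhysics.StatisticalMechanics.LennardJonesClusters
import Literature.MathematicalPhysics.StatisticalMechanics.LocalMatchingCompactness
import Literature.MathematicalPhysics.StatisticalMechanics.LocalLimitOfGroundStates

/-!
# Disproof of `AlphabetGoodHullElement` (stmt-AtomisticToContinuum-15798, route `DisclinationRation`,
# K1, rank 2, difficulty open-problem) — findings of the cdisprove seat, cycle 1 (2026-08-17)

VERDICT OF THE CYCLE: NO KILL.  The crux is the crystallization problem in hull form ("some local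
limit of the ground states is a perfect alphabet-crystal"); its only hypothesis is
`∀ N, IsGroundState lennardJones (x N)`, about which nothing rigorous is known at large `N` beyond
uniform separation (`LennardJonesMinimalDistance_holds`, δ = 1/3), a bond radius and site-energy
bounds — so no rigorous witness against it exists, and the numerics give no competitor either
(below).  What this file DOES establish, sorry-free (axioms propext / Classical.choice / Quot.sound):

§0 `alphabetGoodHullElement_iff` — the crux named clause by clause (`decaPattern`, `AlphabetGood`,
   `IsHullElementOf`, `Separated`, `RelDense`, `HasGoodHullElement`); `Iff.rfl`.
§1 LOAD-BEARING HYPOTHESIS (the only one): energy minimality.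
   * `alphabetGoodHullElement_false_without_minimality : ¬ AlphabetGoodHullElementWithoutMinimality`
     (`IsGroundState` weakened to `Function.Injective`): the collinear chain `x N i = i • e₀` has NO
     relatively dense rooted hull element (`chain_no_relDense_hullElement`).
   * `alphabetGoodHullElementFor_zero_false : ¬ AlphabetGoodHullElementFor (fun _ => 0)`: the same
     chain is a ground-state sequence of the ZERO potential, so the crux's shape is false for `V = 0`
     — cohesion of `lennardJones` must be used before any shell pattern enters.
   LANDED (inline spellings, no defs) as `Theorems/AlphabetGoodHullElement/Negative/Minimality.lean`
   (p167111: `not_hullShape_of_injective`, `alphabetGoodHullElement_false_without_minimality`,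
   `not_hullShape_of_isGroundState_zero`, `alphabetGoodHullElement_false_for_zero_potential`).
§2 NATURAL STRENGTHENING REFUTED: `∃ S` ↦ `∀ S`.
   * `exists_flat_hullElement`: EVERY uniformly separated family has a rooted hull element inside the
     half-space `{p | p 0 ≤ 0}` (recentre at a particle of maximal first coordinate + compactness
     `exists_subseq_forall_eventually_ballMatch`); `exists_hullElement_not_relDense`: so every LJ
     ground-state sequence has a rooted separated hull element that is NOT relatively dense;
     `not_everyRootedHullElementRelDense`.
   LANDED as `Theorems/AlphabetGoodHullElement/Negative/FlatHullElement.lean` (p167130).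
   * SHARPER (landed as `Theorems/AlphabetGoodHullElement/Negative/RootNotGood.lean`, p167889):
     `not_alphabetGood_of_flat` — the crux's clause `GA S y` (verbatim) FAILS whenever
     `S ⊆ {s | s 0 ≤ y 0}`, because each of the three patterns sees every direction
     (`hge_fcc_cover`, `hge_hcp_cover`, prover's `agrd_dec_cover`: `‖u‖ ≤ 5⟪u, v⟫`) while a linear
     isometry is onto (`no_flat_match`: some pattern image has first coordinate `≥ 1/5 > 1/20`);
     hence `exists_rooted_hullElement_root_not_good`: EVERY LJ ground-state sequence has a rooted
     separated hull element whose ROOT is not alphabet-good; `not_forall_rooted_hullElement_root_good`.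
   Moral: surfaces (and any boundedly-many-defect phenomenon) live in the hull but never refute the
   crux; a witness against it must put non-good sites at bounded distance from EVERY particle of ALL
   large ground states of some sequence.  Conversely the prover must CHOOSE centres (clean-ball
   pigeonhole, `stub_alphabetCleanHullElement` of line `birth`).
§3 (doc only) WHY IT RESISTS — attacks that found nothing:
   * typing traps: none.  Patterns are UNIT vectors (`fccKissingPattern = scaledPattern fccInt 2`,
     `hcpKissingPattern = scaledPattern hcpInt 18`), so rescaling by the nearest-neighbour distance
     `d` is consistent; `d = sInf … ≥ δ > 0` on separated sets and `d = 0 ⇒ T = ∅ ⇒ ¬good` (no junk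
     goodness); the cutoff is STRICT (`< 13/10·d`) and the tolerance CLOSED (`≤ 1/20`), exactly the
     orientation that passes to local limits (annulus `(21/20·d, 13/10·d)` empty at good sites), cf.
     `siteGood_radialTight`, `hge_patternGood_of_limit`; the route's GF clause is definitionally
     `Theorems.SiteGood`.
   * vacuity: no — ground states exist for every `N` (`LennardJonesGroundStatesExist_holds`).
   * triviality: no — relative denseness + the first matching clause force `S` to be a genuine local
     limit; `0 ∈ S` and `δ`-separation are mere normalisations (translate; δ = 1/3 is inherited).
   * degenerate regimes: small `N` is invisible (`φ j → ∞`); the finite-size icosahedral (N ≲ 1.6e3)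
     and Marks-decahedral (N ≲ 1e5) LJ global minima (Doye–Calvo) do not bear on local limits, and a
     decahedral column is everywhere alphabet-good anyway (axis atoms: the typed D₅ₕ shell; ring atoms:
     twin-plane anticuboctahedra; second shell of an axis atom at ≈ √2·d > 13/10·d; strain ≈ 2 % < 5 %).
   * competing bulk phases (the honest threat, numerics only): Δ_fcc/hcp(12,6) = −1.00994e-4,
     Δ_bcc/hcp(12,6) = −4.53763e-2 [Schwerdtfeger–Burrows–Smits 2020, arXiv:2012.05413 p. 35: "hcp is
     preferred over bcc through a range of (n,m) values"]; A15 +0.086, simple hexagonal +0.153 (route,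
     crux 11958 LP-RESULTS).  Nothing within 1e-2 of e(hcp) = −0.7176 outside the alphabet is known;
     every relaxed Barlow stacking is everywhere {fcc,hcp}-good.  A rigorous `¬` would need a proof
     that some NON-alphabet structure beats all alphabet-good ones in the bulk — the negation of the
     crystallization conjecture.
§4 (doc only) LINE `birth` (PICKED): joint sufficiency is kernel-checked (`AlphabetGoodHullElement_of`);
   `stub_alphabetGoodRelDense` and `stub_alphabetCleanHullElement` are meanwhile LANDED by provers
   (`DisclinationRationAlphabetGoodHullElementStub*.lean`; `agrd_dec_cover`, `agrd_dec_finset`), and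
   `DisclinationRationAlphabetGoodHullElementReduction.lean` proves
   `ZeroDefectDensity (12086) → AlphabetGoodHullElement`: the crux is formally WEAKER than the sibling
   sitewise crux, so a refutation here would refute 12086 and every sitewise route at once (route KILL
   CRITERIA) — consistent with "no kill".  `stub_zeroAlphabetDefectDensity` (finite-N density form) is
   STRICTLY STRONGER than the crux (the crux needs clean balls of radius → ∞ along a subsequence only) and
   carries all the open-problem content — no misstatement found (surface particles are bad but are
   O(N^{2/3}); relaxed hcp c/a deviation ~1e-4 ≪ 1/20).  No stub is attackable by small models.
-/

noncomputable section

namespace Summit.AtomisticToContinuum.Crystallization.Cruxes.AlphabetGoodHullElement.Disproof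

open Literature.MathematicalPhysics.StatisticalMechanics Literature.Geometry.DiscreteGeometry
open Filter Topology Metric

/-! ## 0. The crux, named clause by clause (definitional: `alphabetGoodHullElement_iff` is `Iff.rfl`) -/

/-- The route's twelve-point decahedral-axis pattern `{±e₃} ∪ {(√3/2·cos(2πk/5), √3/2·sin(2πk/5), ±1/2)}`
(verbatim the set inlined in the crux). [folklore] -/
def decaPattern : Set (EuclideanSpace ℝ (Fin 3)) :=
  {p : EuclideanSpace ℝ (Fin 3) | p = !₂[(0 : ℝ), 0, 1] ∨ p = !₂[(0 : ℝ), 0, -1] ∨ ∃ k : Fin 5, ∃ σ : ℝ, (σ = 1 / 2 ∨ σ = -(1 / 2)) ∧ p = !₂[Real.sqrt 3 / 2 * Real.cos (2 * Real.pi * (k : ℝ) / 5), Real.sqrt 3 / 2 * Real.sin (2 * Real.pi * (k : ℝ) / 5), σ]}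

/-- `AlphabetGood S y` — verbatim the crux's inlined predicate `GA S y`: the strict `13/10·d` shell of
`y` in `S` (`d = dist(y, S ∖ {y})`, an `sInf`), rescaled by `d⁻¹`, is `1/20`-matched through a
bijection and a linear isometry to the fcc, the hcp or the decahedral-axis pattern. [folklore] -/
def AlphabetGood (S : Set (EuclideanSpace ℝ (Fin 3))) (y : EuclideanSpace ℝ (Fin 3)) : Prop :=
  let d : ℝ := sInf ((fun z => dist z y) '' (S \ {y}))
  let T : Set (EuclideanSpace ℝ (Fin 3)) :=
    {z : EuclideanSpace ℝ (Fin 3) | z ∈ S ∧ z ≠ y ∧ dist z y < 13 / 10 * d}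
  ∃ A : EuclideanSpace ℝ (Fin 3) →ₗᵢ[ℝ] EuclideanSpace ℝ (Fin 3),
    (∃ e : ↥T ≃ ↥Literature.Geometry.DiscreteGeometry.fccKissingPattern, ∀ t : ↥T,
      dist (d⁻¹ • ((t : EuclideanSpace ℝ (Fin 3)) - y))
        (A ((e t : ↥Literature.Geometry.DiscreteGeometry.fccKissingPattern) : EuclideanSpace ℝ (Fin 3))) ≤ 1 / 20) ∨
    (∃ e : ↥T ≃ ↥Literature.Geometry.DiscreteGeometry.hcpKissingPattern, ∀ t : ↥T,
      dist (d⁻¹ • ((t : EuclideanSpace ℝ (Fin 3)) - y))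
        (A ((e t : ↥Literature.Geometry.DiscreteGeometry.hcpKissingPattern) : EuclideanSpace ℝ (Fin 3))) ≤ 1 / 20) ∨
    (∃ e : ↥T ≃ ↥decaPattern, ∀ t : ↥T,
      dist (d⁻¹ • ((t : EuclideanSpace ℝ (Fin 3)) - y)) (A ((e t : ↥decaPattern) : EuclideanSpace ℝ (Fin 3))) ≤ 1 / 20)

/-- `IsHullElementOf x S` — verbatim the crux's `HL x S`: translates `x (φ j) + τ j` of a subsequence
are two-way `ε`-matched with `S` on every ball `‖·‖ ≤ R`, eventually in `j`. [folklore] -/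
def IsHullElementOf (x : (N : ℕ) → (Fin N → EuclideanSpace ℝ (Fin 3)))
    (S : Set (EuclideanSpace ℝ (Fin 3))) : Prop :=
  ∃ φ : ℕ → ℕ, StrictMono φ ∧ ∃ τ : ℕ → EuclideanSpace ℝ (Fin 3), ∀ R ε : ℝ, 0 < ε →
    ∀ᶠ j : ℕ in Filter.atTop,
      (∀ s ∈ S, ‖s‖ ≤ R → ∃ i : Fin (φ j), dist (x (φ j) i + τ j) s ≤ ε) ∧
      (∀ i : Fin (φ j), ‖x (φ j) i + τ j‖ ≤ R → ∃ s ∈ S, dist (x (φ j) i + τ j) s ≤ ε)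

/-- `δ`-separation of a point set. [folklore] -/
def Separated (δ : ℝ) (S : Set (EuclideanSpace ℝ (Fin 3))) : Prop :=
  ∀ y ∈ S, ∀ z ∈ S, y ≠ z → δ ≤ dist y z

/-- Relative denseness (verbatim the crux's last conjunct). [folklore] -/
def RelDense (S : Set (EuclideanSpace ℝ (Fin 3))) : Prop :=
  ∃ R₁ : ℝ, ∀ p : EuclideanSpace ℝ (Fin 3), ∃ y ∈ S, dist y p ≤ R₁

/-- The conclusion of the crux for ONE family `x` of finite configurations: some rooted,
separated, everywhere alphabet-good, relatively dense hull element. [folklore] -/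
def HasGoodHullElement (x : (N : ℕ) → (Fin N → EuclideanSpace ℝ (Fin 3))) : Prop :=
  ∃ S : Set (EuclideanSpace ℝ (Fin 3)), ∃ δ : ℝ, 0 < δ ∧ Separated δ S ∧
    (0 : EuclideanSpace ℝ (Fin 3)) ∈ S ∧ IsHullElementOf x S ∧ (∀ y ∈ S, AlphabetGood S y) ∧ RelDense S

/-- The crux is, definitionally, "every sequence of Lennard-Jones ground states `HasGoodHullElement`".
[folklore] -/
theorem alphabetGoodHullElement_iff :
    Summit.AtomisticToContinuum.Crystallization.Theses.DisclinationRation.AlphabetGoodHullElement ↔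
      ∀ x : (N : ℕ) → (Fin N → EuclideanSpace ℝ (Fin 3)),
        (∀ N, IsGroundState lennardJones (x N)) → HasGoodHullElement x :=
  Iff.rfl

/-! ## 1. Load-bearing hypothesis: energy minimality (`IsGroundState` beyond injectivity) -/

/-- The crux with `IsGroundState lennardJones (x N)` WEAKENED to its first conjunct
`Function.Injective (x N)` (distinct particles, no energy condition). [folklore] -/
def AlphabetGoodHullElementWithoutMinimality : Prop :=
  ∀ x : (N : ℕ) → (Fin N → EuclideanSpace ℝ (Fin 3)),
    (∀ N, Function.Injective (x N)) → HasGoodHullElement x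

/-- The collinear chain `x N i = i • e₀` (spacing `1`, `1`-separated, every particle bonded). [folklore] -/
def chain : (N : ℕ) → (Fin N → EuclideanSpace ℝ (Fin 3)) :=
  fun _ i => ((i : ℕ) : ℝ) • EuclideanSpace.single (0 : Fin 3) (1 : ℝ)

/-- The chain has distinct particles. [folklore] -/
theorem chain_injective (N : ℕ) : Function.Injective (chain N) := by
  intro i j h
  have hv : (EuclideanSpace.single (0 : Fin 3) (1 : ℝ) : EuclideanSpace ℝ (Fin 3)) ≠ 0 := by simp
  have h' : ((i : ℕ) : ℝ) = ((j : ℕ) : ℝ) := smul_left_injective ℝ hv h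
  exact Fin.ext (by exact_mod_cast h')

/-- A coordinate difference is at most the Euclidean distance. [folklore] -/
theorem abs_sub_apply_le_dist (a b : EuclideanSpace ℝ (Fin 3)) (k : Fin 3) :
    |a k - b k| ≤ dist a b := by
  have h := PiLp.dist_apply_le a b k
  rwa [Real.dist_eq] at h

/-- **No relatively dense rooted hull element of the chain.** Every local limit `S ∋ 0` of
translates of the collinear chain fails to be relatively dense (it lies on the line `ℝ e₀`; we only
use that its second coordinates vanish). [folklore] -/
theorem chain_no_relDense_hullElement {S : Set (EuclideanSpace ℝ (Fin 3))}
    (h0 : (0 : EuclideanSpace ℝ (Fin 3)) ∈ S) (hHL : IsHullElementOf chain S) (hRD : RelDense S) :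
    False := by
  obtain ⟨φ, -, τ, hmatch⟩ := hHL
  obtain ⟨R₁, hR₁⟩ := hRD
  obtain ⟨y, hyS, hyq⟩ := hR₁ (EuclideanSpace.single (1 : Fin 3) (|R₁| + 1))
  -- the second coordinate of `y` is at least `1`
  have hy1 : 1 ≤ y 1 := by
    have h := abs_sub_apply_le_dist y (EuclideanSpace.single (1 : Fin 3) (|R₁| + 1)) 1
    have hq : (EuclideanSpace.single (1 : Fin 3) (|R₁| + 1) : EuclideanSpace ℝ (Fin 3)) 1 = |R₁| + 1 := by
      simp
    rw [hq] at h
    have h' : |y 1 - (|R₁| + 1)| ≤ |R₁| := (h.trans hyq).trans (le_abs_self R₁)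
    have h'' := (abs_le.1 h').1
    linarith
  -- match at radius `‖y‖`, tolerance `1/4`
  obtain ⟨j, hj⟩ := (hmatch ‖y‖ (1 / 4) (by norm_num)).exists
  obtain ⟨i, hi⟩ := hj.1 y hyS le_rfl
  obtain ⟨i', hi'⟩ := hj.1 0 h0 (by simp)
  have e1 : (chain (φ j) i + τ j) 1 = τ j 1 := by simp [chain]
  have e2 : (chain (φ j) i' + τ j) 1 = τ j 1 := by simp [chain]
  have a1 := abs_sub_apply_le_dist (chain (φ j) i + τ j) y 1
  have a2 := abs_sub_apply_le_dist (chain (φ j) i' + τ j) 0 1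
  rw [e1] at a1
  rw [e2] at a2
  have b1 := abs_le.1 (a1.trans hi)
  have b2 := abs_le.1 (a2.trans hi')
  have hz : (0 : EuclideanSpace ℝ (Fin 3)) 1 = 0 := rfl
  rw [hz] at b2
  linarith [b1.1, b1.2, b2.1, b2.2]

/-- **Any proof must use energy minimality**: with `IsGroundState` weakened to injectivity the crux
is false — the collinear chain has no relatively dense rooted hull element at all (let alone an
everywhere alphabet-good one). [folklore] -/
theorem alphabetGoodHullElement_false_without_minimality : ¬ AlphabetGoodHullElementWithoutMinimality := by
  intro h
  obtain ⟨S, δ, -, -, h0, hHL, -, hRD⟩ := h chain chain_injective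
  exact chain_no_relDense_hullElement h0 hHL hRD

/-- The crux's shape for an ARBITRARY pair potential `V` in place of `lennardJones`. [folklore] -/
def AlphabetGoodHullElementFor (V : ℝ → ℝ) : Prop :=
  ∀ x : (N : ℕ) → (Fin N → EuclideanSpace ℝ (Fin 3)), (∀ N, IsGroundState V (x N)) → HasGoodHullElement x

/-- The crux is the `V = lennardJones` instance (definitional). [folklore] -/
theorem alphabetGoodHullElement_iff_for :
    Summit.AtomisticToContinuum.Crystallization.Theses.DisclinationRation.AlphabetGoodHullElement ↔
      AlphabetGoodHullElementFor lennardJones :=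
  Iff.rfl

/-- **The potential is load-bearing**: for the zero potential every configuration of distinct
points is a ground state (`isGroundState_zero`), in particular the collinear chain, so the crux's
shape FAILS for `V = 0` — any proof must use a property of `lennardJones` that forces
three-dimensional, relatively dense local limits (cohesion), before any pattern is discussed.
[folklore] -/
theorem alphabetGoodHullElementFor_zero_false : ¬ AlphabetGoodHullElementFor (fun _ => 0) := by
  intro h
  obtain ⟨S, δ, -, -, h0, hHL, -, hRD⟩ := h chain fun N => isGroundState_zero (chain_injective N)
  exact chain_no_relDense_hullElement h0 hHL hRD

/-! ## 2. Natural strengthening refuted: NOT EVERY rooted hull element is relatively dense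
(surfaces are in the hull of every ground-state sequence) -/

/-- **Flat hull elements exist for every uniformly separated family.** Recentring each `x (k+1)` at a
particle of maximal first coordinate and extracting a locally convergent subsequence (compactness of
`δ`-separated sets in the local matching topology) gives a `δ`-separated hull element `S ∋ 0` of `x`
contained in the closed half-space `{p | p 0 ≤ 0}`. [folklore] -/
theorem exists_flat_hullElement (x : (N : ℕ) → (Fin N → EuclideanSpace ℝ (Fin 3))) {δ : ℝ} (hδ : 0 < δ)
    (hsep : ∀ N, ∀ i j : Fin N, i ≠ j → δ ≤ dist (x N i) (x N j)) :
    ∃ S : Set (EuclideanSpace ℝ (Fin 3)), Separated δ S ∧ (0 : EuclideanSpace ℝ (Fin 3)) ∈ S ∧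
      IsHullElementOf x S ∧ ∀ s ∈ S, s 0 ≤ 0 := by
  classical
  have hc : ∀ k : ℕ, ∃ i₀ : Fin (k + 1), ∀ i : Fin (k + 1), x (k + 1) i 0 ≤ x (k + 1) i₀ 0 :=
    fun k => Finite.exists_max fun i : Fin (k + 1) => x (k + 1) i 0
  choose i₀ hi₀ using hc
  set c : ℕ → EuclideanSpace ℝ (Fin 3) := fun k => -x (k + 1) (i₀ k) with hcdef
  set Y : ℕ → Set (EuclideanSpace ℝ (Fin 3)) := fun k => Set.range fun i => x (k + 1) i + c k with hYdef
  have hYsep : ∀ k, ∀ p ∈ Y k, ∀ q ∈ Y k, p ≠ q → δ ≤ dist p q := by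
    intro k
    rintro _ ⟨i, rfl⟩ _ ⟨i', rfl⟩ hne
    rw [dist_add_right]
    exact hsep _ i i' fun h => hne (by simp [h])
  have hYflat : ∀ k, ∀ p ∈ Y k, p 0 ≤ 0 := by
    intro k
    rintro _ ⟨i, rfl⟩
    have := hi₀ k i
    simp only [hcdef, PiLp.add_apply, PiLp.neg_apply]
    linarith
  have h0Y : ∀ k, (0 : EuclideanSpace ℝ (Fin 3)) ∈ Y k := fun k => ⟨i₀ k, by simp [hcdef]⟩
  obtain ⟨φ₁, S, hφ₁, hSsep, hlim⟩ := exists_subseq_forall_eventually_ballMatch hδ Y hYsep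
  refine ⟨S, hSsep, ?_, ?_, ?_⟩
  · exact Summit.AtomisticToContinuum.Crystallization.Theorems.hge_mem_of_tendsto hδ hSsep hlim
      (Eventually.of_forall fun k => h0Y (φ₁ k)) tendsto_const_nhds
  · refine ⟨fun j => φ₁ j + 1, fun a b hab => Nat.add_lt_add_right (hφ₁ hab) 1, fun j => c (φ₁ j), ?_⟩
    intro R ε hε
    filter_upwards [hlim R ε hε] with j hj
    exact (ballMatch_zero_range_iff (fun i => x (φ₁ j + 1) i + c (φ₁ j)) ε R).1 hj
  · intro s hs
    obtain ⟨hpY, hps⟩ := Summit.AtomisticToContinuum.Crystallization.Theorems.hge_exists_approx hδ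
      (fun k => hYsep (φ₁ k)) hlim hs
    have hcont : Continuous fun p : EuclideanSpace ℝ (Fin 3) => p 0 := PiLp.continuous_apply 2 _ 0
    have hclosed : IsClosed {p : EuclideanSpace ℝ (Fin 3) | p 0 ≤ 0} := isClosed_le hcont continuous_const
    exact hclosed.mem_of_tendsto hps (hpY.mono fun k hk => hYflat _ _ hk)

/-- A set in the half-space `{p | p 0 ≤ 0}` is not relatively dense in `ℝ³`. [folklore] -/
theorem not_relDense_of_flat {S : Set (EuclideanSpace ℝ (Fin 3))} (hS : ∀ s ∈ S, s 0 ≤ 0) :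
    ¬ RelDense S := by
  rintro ⟨R₁, hR₁⟩
  obtain ⟨y, hyS, hyq⟩ := hR₁ (EuclideanSpace.single (0 : Fin 3) (|R₁| + 1))
  have h := abs_sub_apply_le_dist y (EuclideanSpace.single (0 : Fin 3) (|R₁| + 1)) 0
  have hq : (EuclideanSpace.single (0 : Fin 3) (|R₁| + 1) : EuclideanSpace ℝ (Fin 3)) 0 = |R₁| + 1 := by
    simp
  rw [hq] at h
  have h' : |y 0 - (|R₁| + 1)| ≤ |R₁| := (h.trans hyq).trans (le_abs_self R₁)
  have h'' := (abs_le.1 h').1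
  have hy := hS y hyS
  linarith

/-- **The ∃ over hull elements is load-bearing.** For EVERY sequence of Lennard-Jones ground states
there is a rooted, separated hull element that is NOT relatively dense (a crystal surface seen from a
particle of maximal first coordinate): the natural strengthening "every rooted hull element is
relatively dense and everywhere good" of the crux is false, and no refutation of the crux can come
from surface- or boundedly-many-defect phenomena — a witness against the crux must put non-good
sites at bounded distance from EVERY particle of ALL large ground states. Uses the landed
`LennardJonesMinimalDistance_holds` (δ = 1/3). [folklore] -/
theorem exists_hullElement_not_relDense (x : (N : ℕ) → (Fin N → EuclideanSpace ℝ (Fin 3)))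
    (hx : ∀ N, IsGroundState lennardJones (x N)) :
    ∃ S : Set (EuclideanSpace ℝ (Fin 3)), ∃ δ : ℝ, 0 < δ ∧ Separated δ S ∧
      (0 : EuclideanSpace ℝ (Fin 3)) ∈ S ∧ IsHullElementOf x S ∧ ¬ RelDense S := by
  obtain ⟨δ, hδ, hsepall⟩ := LennardJonesMinimalDistance_holds
  obtain ⟨S, hSsep, h0, hHL, hflat⟩ :=
    exists_flat_hullElement x hδ fun N i j hij => hsepall N (x N) (hx N) i j hij
  exact ⟨S, δ, hδ, hSsep, h0, hHL, not_relDense_of_flat hflat⟩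

/-- The natural strengthening of the crux in which the hull element is not chosen but arbitrary:
"every rooted hull element of a ground-state sequence is relatively dense". [folklore] -/
def EveryRootedHullElementRelDense : Prop :=
  ∀ x : (N : ℕ) → (Fin N → EuclideanSpace ℝ (Fin 3)), (∀ N, IsGroundState lennardJones (x N)) →
    ∀ S : Set (EuclideanSpace ℝ (Fin 3)), (0 : EuclideanSpace ℝ (Fin 3)) ∈ S → IsHullElementOf x S →
      RelDense S

/-- **Refuted strengthening**: `EveryRootedHullElementRelDense` is false (ground states exist for
every `N`, `LennardJonesGroundStatesExist_holds`, and every ground-state sequence has a flat rooted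
hull element). [folklore] -/
theorem not_everyRootedHullElementRelDense : ¬ EveryRootedHullElementRelDense := by
  intro h
  have hex := LennardJonesGroundStatesExist_holds
  choose x hx using hex
  obtain ⟨S, δ, -, -, h0, hHL, hnot⟩ := exists_hullElement_not_relDense x hx
  exact hnot (h x hx S h0 hHL)

end Summit.AtomisticToContinuum.Crystallization.Cruxes.AlphabetGoodHullElement.Disproof

end
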